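import Mathlib
import HarnessLib
import Literature.MathematicalPhysics.KineticTheory.HardSphereEulerProofs
import Literature.Analysis.FluidPDE.HardSphereFlowJointMeasurable
import Summits.AtomisticToContinuum.HydrodynamicLimit.Theorems.BoltzmannGreenKubo.Negative.Stationarity
import Summits.AtomisticToContinuum.HydrodynamicLimit.Theorems.AntiMazurCoboundariesShearStressHalfDrudeDisplacement
import Summits.AtomisticToContinuum.HydrodynamicLimit.Theorems.OneFlightGossipEngineKineticCurrentsWindowLDApriori
import Summits.AtomisticToContinuum.HydrodynamicLimit.Theorems.OneFlightGossipEngineEquilibriumStressVarianceDecayWindows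

/-!
# Window transfer for isothermal local Gibbs laws — stub `stub_windowTransfer_isothermal`

Isothermal instance (constant drift `u₀` and temperature `θ₀`, ARBITRARY continuous activity
`a > 0`) of the window-transfer stub S5 of line `Sketch` for the crux
`KineticCurrentsWindowLDUniform` (stmt-AtomisticToContinuum-14662): single-time expectations
`∫ G(Φ_r z) dλ` under the local Gibbs law `λ = λ^N_{a,u₀,θ₀}` at times `r` in the kinetic window
`[0, τ(N+1)^{-1/3}]` are moved back to time `0` at cost `e^{δ(N+1)}` and Rényi exponent `q = 2`.

Proof. `λ = ψ · L` with `L` the Liouville measure and `ψ = Z⁻¹ 𝟙_D ∏ᵢ a(xᵢ) M_{θ₀,u₀}(vᵢ)`.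
With constant `u₀, θ₀` the Maxwellian factor is conserved along good orbits (energy and momentum,
`BoltzmannGreenKuboOrthMomentum.tensorPow_localGibbsProfile_const_flow`), so on the good set
`ψ(z) = ψ(Φ_r z) · R(z)` with `R(z) = exp Σᵢ (log a(xᵢ(0)) − log a(xᵢ(r)))` (cocycle). Hence
`∫ G∘Φ_r dλ = ∫ (G∘Φ_r) · R dν` with `ν = (ψ∘Φ_r) · L`; Cauchy–Schwarz in `ℝ≥0∞` gives
`(∫ (G∘Φ_r)² dν)^{1/2} (∫ R² dν)^{1/2}`; the first factor is `(∫ G² dλ)^{1/2}` by Liouville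
invariance. For the second, uniform continuity of `log a` on `𝕋³` gives
`log a(x) − log a(y) ≤ δ/2 + C dist(y,x)²`, the displacement of particle `i` over `[0,r]` is at
most `∫₀ʳ ‖vᵢ‖` (`ShearStressHalfDrudeDisplacement.euclidDist_flow_le_integral_norm_vel`),
Cauchy–Schwarz and `Σᵢ ∫₀ʳ ‖vᵢ‖² = 2E(z) r` give `2 log R ≤ δ(N+1) + 4 C r² E(z)`; the Gaussian
energy moments of `λ` (`lintegral_exp_mul_configEnergy_localGibbsLaw_le`) are `≤ e^{δ(N+1)}` once
`4 C r² ≤ γ(δ, θ₀, ‖u₀‖)`, which holds on the kinetic window for `N ≥ N₀` since `w_N → 0`.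
No collision counting is needed.
-/

noncomputable section

open MeasureTheory Set Filter
open scoped ENNReal Topology

namespace Summit.AtomisticToContinuum.HydrodynamicLimit.Theorems.KineticCurrentsWindowLDUniformSketch

open Literature.Analysis.FluidPDE (HardSphereFlow Config localMaxwellian)
open Literature.MathematicalPhysics.KineticTheory (T3 V3 hsDiameter localGibbsLaw localGibbsMeasure)
open Literature.Analysis.FluidPDE Literature.MathematicalPhysics.KineticTheory

/-! ### Static helpers -/

/-- Log-increments of a continuous positive function on `𝕋³` are uniformly small up to a
quadratic penalty in the minimal-image distance: for every `κ > 0` there is `C ≥ 0` with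
`log a x − log a y ≤ κ + C · dist_{𝕋³}(y, x)²` (uniform continuity below a scale `ℓ`, the
oscillation bound `2 sup |log a|` above it). [folklore] -/
private theorem log_sub_log_le_quad {a : T3 → ℝ} (ha : Continuous a) (ha0 : ∀ x, 0 < a x)
    {κ : ℝ} (hκ : 0 < κ) :
    ∃ C : ℝ, 0 ≤ C ∧ ∀ x y : T3,
      Real.log (a x) - Real.log (a y) ≤ κ + C * Torus.euclidDist y x ^ 2 := by
  have hg : Continuous fun x => Real.log (a x) := ha.log fun x => (ha0 x).ne'
  obtain ⟨B, hB0, hB⟩ := exists_forall_abs_le_of_continuous hg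
  obtain ⟨ℓ, hℓ, huc⟩ := Metric.uniformContinuous_iff.1
    (CompactSpace.uniformContinuous_of_continuous hg) κ hκ
  refine ⟨2 * B / ℓ ^ 2, by positivity, fun x y => ?_⟩
  have hnn : 0 ≤ 2 * B / ℓ ^ 2 * Torus.euclidDist y x ^ 2 := by positivity
  by_cases hd : Torus.euclidDist y x < ℓ
  · have hxy : dist x y < ℓ := by
      rw [dist_eq_norm]
      exact (Torus.norm_sub_le_euclidDist_holds x y).trans_lt (by rwa [Torus.euclidDist_comm])
    have h := huc hxy
    rw [Real.dist_eq] at h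
    linarith [(le_abs_self _).trans_lt h]
  · rw [not_lt] at hd
    have h1 : Real.log (a x) - Real.log (a y) ≤ 2 * B := by
      linarith [(abs_le.1 (hB x)).2, (abs_le.1 (hB y)).1]
    have h2 : 2 * B ≤ 2 * B / ℓ ^ 2 * Torus.euclidDist y x ^ 2 := by
      rw [div_mul_eq_mul_div, le_div_iff₀ (by positivity)]
      exact mul_le_mul_of_nonneg_left (pow_le_pow_left₀ hℓ.le hd 2) (by positivity)
    linarith

/-- **Activity log-ratio along a good orbit is controlled by the conserved energy.** If
`g x − g y ≤ κ + C dist(y,x)²`, then over a window `[0, r]`,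
`Σᵢ (g(xᵢ(0)) − g(xᵢ(r))) ≤ n κ + C · 2 r² E(z)` (displacement `≤ ∫₀ʳ ‖vᵢ‖`, Cauchy–Schwarz,
`Σᵢ ∫₀ʳ ‖vᵢ‖² = 2 E(z) r`). [folklore] -/
private theorem sum_log_ratio_le {ε : ℝ} {n : ℕ}
    (Φ : HardSphereFlow (Torus.geometry (Fin 3)) ε n) {z : Config n (Fin 3) T3} (hz : z ∈ Φ.good)
    {g : T3 → ℝ} {κ C : ℝ} (hC : 0 ≤ C)
    (hg : ∀ x y : T3, g x - g y ≤ κ + C * Torus.euclidDist y x ^ 2) {r : ℝ} (hr : 0 ≤ r) :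
    ∑ i, (g (z i).1 - g (Φ.flow r z i).1) ≤ n * κ + C * (2 * r ^ 2 * configEnergy z) := by
  obtain ⟨hint2, hsum⟩ := sum_window_integral_norm_sq_eq Φ hz r
  have hγm : Measurable fun t => Φ.flow t z := (Φ.isTrajectory z hz).measurable_torus
  have hint1 : ∀ i, IntervalIntegrable (fun s => ‖(Φ.flow s z i).2‖) volume 0 r := fun i =>
    (intervalIntegrable_const (c := Real.sqrt (2 * configEnergy z))).mono_fun'
      ((measurable_pi_apply i).comp hγm).snd.norm.aestronglyMeasurable
      (ae_of_all _ fun s => by simpa only [norm_norm] using Φ.norm_vel_flow_le hz s i)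
  have hdi : ∀ i, Torus.euclidDist (Φ.flow r z i).1 (z i).1 ^ 2 ≤
      r * ∫ s in (0 : ℝ)..r, ‖(Φ.flow s z i).2‖ ^ 2 := fun i =>
    (pow_le_pow_left₀ (norm_nonneg _)
      (ShearStressHalfDrudeDisplacement.euclidDist_flow_le_integral_norm_vel Φ hz i hr) 2).trans
      (EquilibriumStressVarianceDecayC3.sq_integral_le_mul_integral_sq hr (hint1 i) (hint2 i))
  calc ∑ i, (g (z i).1 - g (Φ.flow r z i).1)
      ≤ ∑ i, (κ + C * (r * ∫ s in (0 : ℝ)..r, ‖(Φ.flow s z i).2‖ ^ 2)) :=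
        Finset.sum_le_sum fun i _ =>
          (hg _ _).trans (add_le_add le_rfl (mul_le_mul_of_nonneg_left (hdi i) hC))
    _ = n * κ + C * (2 * r ^ 2 * configEnergy z) := by
        rw [Finset.sum_add_distrib, Finset.sum_const, Finset.card_univ, Fintype.card_fin,
          nsmul_eq_mul, ← Finset.mul_sum, ← Finset.mul_sum, hsum]
        ring

/-- The activity factors out of the tensor power of a local Gibbs profile:
`∏ᵢ a(xᵢ) M(vᵢ) = exp(Σᵢ log a(xᵢ)) · ∏ᵢ M(vᵢ)` for `a > 0`. [folklore] -/
private theorem tensorPow_localGibbsProfile_eq_exp_mul {a : T3 → ℝ} (ha0 : ∀ x, 0 < a x)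
    (u : T3 → V3) (θ : T3 → ℝ) {n : ℕ} (z : Config n (Fin 3) T3) :
    tensorPow n (localGibbsProfile a u θ) z =
      Real.exp (∑ i, Real.log (a (z i).1)) * tensorPow n (localGibbsProfile (fun _ => 1) u θ) z := by
  simp only [tensorPow, localGibbsProfile, one_mul]
  rw [Real.exp_sum, ← Finset.prod_mul_distrib]
  exact Finset.prod_congr rfl fun i _ => by rw [Real.exp_log (ha0 _)]

/-- **Cocycle of the isothermal local Gibbs density along a good orbit.** With constant drift and
temperature the Maxwellian factor is conserved (energy and momentum), so
`ψ(z) = ψ(Φ_t z) · exp Σᵢ (log a(xᵢ(0)) − log a(xᵢ(t)))`. [folklore] -/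
private theorem canonicalDensity_isothermal_cocycle {σ : ℝ} {a : T3 → ℝ} (ha0 : ∀ x, 0 < a x)
    (θ : ℝ) (u : V3) {N : ℕ}
    (Φ : HardSphereFlow (Torus.geometry (Fin 3)) (hsDiameter σ N) (N + 1))
    {z : Config (N + 1) (Fin 3) T3} (hz : z ∈ Φ.good) (t : ℝ) :
    canonicalDensity (Torus.geometry (Fin 3)) (hsDiameter σ N) (N + 1)
        (localGibbsProfile a (fun _ => u) (fun _ => θ)) z =
      canonicalDensity (Torus.geometry (Fin 3)) (hsDiameter σ N) (N + 1)
          (localGibbsProfile a (fun _ => u) (fun _ => θ)) (Φ.flow t z) *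
        Real.exp (∑ i, (Real.log (a (z i).1) - Real.log (a (Φ.flow t z i).1))) := by
  simp only [canonicalDensity]
  rw [indicator_of_mem (Φ.good_subset hz), indicator_of_mem (Φ.good_subset (Φ.mapsTo_good t hz)),
    tensorPow_localGibbsProfile_eq_exp_mul ha0, tensorPow_localGibbsProfile_eq_exp_mul ha0,
    BoltzmannGreenKuboOrthMomentum.tensorPow_localGibbsProfile_const_flow 1 θ u Φ hz t,
    Finset.sum_sub_distrib, Real.exp_sub, mul_div_assoc', eq_div_iff (Real.exp_pos _).ne']
  ring

/-- Choice of the energy exponent: for `δ > 0` there is `γ > 0` with `2γθ₀ < 1` and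
`exp(γU²) (1 − 2γθ₀)^{-3/2} ≤ exp δ` (`(1 − x)⁻¹ ≤ e^{2x}` on `[0, 1/2]`). [folklore] -/
private theorem exists_gamma {θ₀ δ : ℝ} (hθ : 0 < θ₀) (hδ : 0 < δ) (U : ℝ) :
    ∃ γ : ℝ, 0 < γ ∧ 2 * γ * θ₀ < 1 ∧
      Real.exp (γ * U ^ 2) * (1 - 2 * γ * θ₀) ^ (-(3 : ℝ) / 2) ≤ Real.exp δ := by
  obtain ⟨γ, hγ0, hγ1, hγ2⟩ : ∃ γ : ℝ, 0 < γ ∧ γ * (4 * θ₀) ≤ 1 ∧ γ * (U ^ 2 + 6 * θ₀) ≤ δ :=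
    ⟨min (1 / (4 * θ₀)) (δ / (U ^ 2 + 6 * θ₀)), lt_min (by positivity) (by positivity),
      (le_div_iff₀ (by positivity)).1 (min_le_left _ _),
      (le_div_iff₀ (by positivity)).1 (min_le_right _ _)⟩
  have hx0 : 0 ≤ 2 * γ * θ₀ := by positivity
  have hx2 : 2 * γ * θ₀ ≤ 1 / 2 := by linarith
  have hk : 0 < 1 - 2 * γ * θ₀ := by linarith
  have h1 : (1 - 2 * γ * θ₀)⁻¹ ≤ Real.exp (2 * (2 * γ * θ₀)) := by
    rw [inv_le_iff_one_le_mul₀' hk]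
    nlinarith [mul_nonneg hk.le (sub_nonneg.2 (Real.add_one_le_exp (2 * (2 * γ * θ₀)))),
      mul_nonneg hx0 (sub_nonneg.2 hx2)]
  refine ⟨γ, hγ0, by linarith, ?_⟩
  calc Real.exp (γ * U ^ 2) * (1 - 2 * γ * θ₀) ^ (-(3 : ℝ) / 2)
      ≤ Real.exp (γ * U ^ 2) * Real.exp (2 * (2 * γ * θ₀)) ^ ((3 : ℝ) / 2) := by
        rw [show (-(3 : ℝ) / 2) = -((3 : ℝ) / 2) by ring, Real.rpow_neg hk.le,
          ← Real.inv_rpow hk.le]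
        exact mul_le_mul_of_nonneg_left
          (Real.rpow_le_rpow (inv_nonneg.2 hk.le) h1 (by norm_num)) (Real.exp_nonneg _)
    _ = Real.exp (γ * (U ^ 2 + 6 * θ₀)) := by
        rw [← Real.exp_mul, ← Real.exp_add]
        congr 1
        ring
    _ ≤ Real.exp δ := Real.exp_le_exp.2 hγ2

/-- The kinetic window `w_N = τ (N+1)^{-1/3}` tends to `0`, so `C · 4 w_N² < γ` eventually.
[folklore] -/
private theorem exists_N0 (τ C : ℝ) {γ : ℝ} (hγ : 0 < γ) :
    ∃ N₀ : ℕ, ∀ N : ℕ, N₀ ≤ N → C * (4 * (τ * ((N : ℝ) + 1) ^ (-(1 / 3 : ℝ))) ^ 2) < γ := by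
  have h1 : Tendsto (fun N : ℕ => τ * ((N : ℝ) + 1) ^ (-(1 / 3 : ℝ))) atTop (𝓝 (τ * 0)) :=
    ((tendsto_rpow_neg_atTop (by norm_num : (0 : ℝ) < 1 / 3)).comp
      (tendsto_atTop_add_const_right atTop 1 tendsto_natCast_atTop_atTop)).const_mul τ
  have h2 : Tendsto (fun N : ℕ => C * (4 * (τ * ((N : ℝ) + 1) ^ (-(1 / 3 : ℝ))) ^ 2)) atTop
      (𝓝 (C * (4 * (τ * 0) ^ 2))) := ((h1.pow 2).const_mul 4).const_mul C
  rw [mul_zero, zero_pow two_ne_zero, mul_zero, mul_zero] at h2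
  exact eventually_atTop.1 (h2.eventually (gt_mem_nhds hγ))

/-! ### The stub -/

/-- **Window transfer for isothermal local Gibbs laws (S5, isothermal instance).** For a
continuous activity `a > 0` and constant drift `u₀` and temperature `θ₀ > 0`, `0 < σ ≤ 1/2`:
with `q = 2`, for every `τ, δ > 0` and every flow family there is `N₀` such that for `N ≥ N₀`,
every `r` in the kinetic window `[0, τ(N+1)^{-1/3}]` and every measurable `G ≥ 0`,
`∫⁻ G(Φ_r z) dλ ≤ e^{δ(N+1)} (∫⁻ G² dλ)^{1/2}` — the Maxwellian factor of the density is conserved,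
the activity factor changes by the displacement cocycle, which is controlled by the conserved
energy over a vanishing window. [folklore] -/
theorem stub_windowTransfer_isothermal :
    ∀ (a : T3 → ℝ) (θ₀ : ℝ) (u₀ : V3), Continuous a → (∀ x, 0 < a x) → 0 < θ₀ →
      ∀ σ : ℝ, 0 < σ → σ ≤ 1 / 2 →
      ∃ q : ℝ, 1 ≤ q ∧ ∀ τ : ℝ, 0 < τ → ∀ δ : ℝ, 0 < δ →
      ∀ Φ : (N : ℕ) →
        HardSphereFlow (Literature.Analysis.FluidPDE.Torus.geometry (Fin 3)) (hsDiameter σ N) (N + 1),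
      ∃ N₀ : ℕ, ∀ N : ℕ, N₀ ≤ N → ∀ r ∈ Set.Icc (0 : ℝ) (τ * ((N : ℝ) + 1) ^ (-(1 / 3 : ℝ))),
      ∀ G : Config (N + 1) (Fin 3) T3 → ℝ≥0∞, Measurable G →
        ∫⁻ z, G ((Φ N).flow r z) ∂(localGibbsLaw σ a (fun _ => u₀) (fun _ => θ₀) N (Φ N)) ≤
          ENNReal.ofReal (Real.exp (δ * ((N : ℝ) + 1))) *
            (∫⁻ z, G z ^ q ∂(localGibbsLaw σ a (fun _ => u₀) (fun _ => θ₀) N (Φ N))) ^ (1 / q) := by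
  intro a θ₀ u₀ ha ha0 hθ σ _hσ hσ2
  refine ⟨2, by norm_num, fun τ _hτ δ hδ Φ => ?_⟩
  -- static constants: the log-oscillation bound, the energy exponent `γ`, and `N₀`
  obtain ⟨C, hC0, hC⟩ := log_sub_log_le_quad ha ha0 (half_pos hδ)
  obtain ⟨γ, hγ0, hγθ, hK⟩ := exists_gamma hθ hδ ‖u₀‖
  obtain ⟨N₀, hN₀⟩ := exists_N0 τ C hγ0
  refine ⟨N₀, fun N hN r hr G hG => ?_⟩
  -- the Liouville measure, the density `ψ`, the cocycle `R`, the reference measure `ν`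
  set cN : ℝ≥0∞ := ENNReal.ofReal (Real.exp (δ * ((N : ℝ) + 1))) with hcN
  set L := liouville (Torus.geometry (Fin 3)) (N + 1) (hsDiameter σ N) with hL
  set ψ : Config (N + 1) (Fin 3) T3 → ℝ≥0∞ := fun z => ENNReal.ofReal
    (canonicalDensity (Torus.geometry (Fin 3)) (hsDiameter σ N) (N + 1)
      (localGibbsProfile a (fun _ => u₀) (fun _ => θ₀)) z) with hψ
  have hlaw : localGibbsLaw σ a (fun _ => u₀) (fun _ => θ₀) N (Φ N) = L.withDensity ψ := by
    simp only [localGibbsLaw, particleLaw_eq, hL, hψ]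
  have hψm : Measurable ψ :=
    (measurable_canonicalDensity (hsDiameter σ N) (N + 1)
      (measurable_localGibbsProfile ha continuous_const continuous_const)).ennreal_ofReal
  have hΦm : Measurable ((Φ N).flow r) := (Φ N).measurable_flow r
  have hψΦm : Measurable fun z => ψ ((Φ N).flow r z) := hψm.comp hΦm
  have hfm : Measurable fun z => G ((Φ N).flow r z) := hG.comp hΦm
  have hgm : Measurable fun x : T3 => Real.log (a x) := (ha.log fun x => (ha0 x).ne').measurable
  set R : Config (N + 1) (Fin 3) T3 → ℝ≥0∞ := fun z => ENNReal.ofReal (Real.exp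
    (∑ i, (Real.log (a (z i).1) - Real.log (a ((Φ N).flow r z i).1)))) with hR
  have hRm : Measurable R := by
    refine (Real.measurable_exp.comp (Finset.measurable_sum _ fun i _ => ?_)).ennreal_ofReal
    exact (hgm.comp (measurable_pi_apply i).fst).sub
      (hgm.comp ((measurable_pi_apply i).comp hΦm).fst)
  have hfRm : Measurable fun z => G ((Φ N).flow r z) * R z := hfm.mul hRm
  have hEm : Measurable fun z : Config (N + 1) (Fin 3) T3 => configEnergy z := by
    unfold configEnergy
    exact measurable_const.mul (Finset.measurable_sum _ fun i _ =>
      ((measurable_pi_apply i).snd.norm.pow_const 2))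
  set Q : Config (N + 1) (Fin 3) T3 → ℝ≥0∞ := fun w =>
    ENNReal.ofReal (Real.exp (γ * configEnergy w)) with hQ
  have hQm : Measurable Q := (Real.measurable_exp.comp (hEm.const_mul γ)).ennreal_ofReal
  have hψQm : Measurable fun w => ψ w * Q w := hψm.mul hQm
  set ν := L.withDensity (fun z => ψ ((Φ N).flow r z)) with hν
  -- Steps 1–2: cocycle and change of measure
  have hlhs : ∫⁻ z, G ((Φ N).flow r z) ∂(localGibbsLaw σ a (fun _ => u₀) (fun _ => θ₀) N (Φ N)) =
      ∫⁻ z, G ((Φ N).flow r z) * R z ∂ν := by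
    rw [hν, lintegral_withDensity_eq_lintegral_mul L hψΦm hfRm, hlaw,
      lintegral_withDensity_eq_lintegral_mul L hψm hfm]
    refine lintegral_congr_ae ?_
    filter_upwards [(Φ N).ae_mem_good] with z hz
    simp only [Pi.mul_apply, hψ, hR]
    rw [canonicalDensity_isothermal_cocycle ha0 θ₀ u₀ (Φ N) hz r,
      ENNReal.ofReal_mul' (Real.exp_nonneg _)]
    ring
  -- Step 4: the first Hölder factor is the time-`0` norm (Liouville invariance)
  have hfirst : ∫⁻ z, G ((Φ N).flow r z) ^ (2 : ℝ) ∂ν =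
      ∫⁻ z, G z ^ (2 : ℝ) ∂(localGibbsLaw σ a (fun _ => u₀) (fun _ => θ₀) N (Φ N)) := by
    rw [hν, lintegral_withDensity_eq_lintegral_mul L hψΦm (hfm.pow_const (2 : ℝ)), hlaw,
      lintegral_withDensity_eq_lintegral_mul L hψm (hG.pow_const (2 : ℝ))]
    exact ((Φ N).measurePreserving r).lintegral_comp (hψm.mul (hG.pow_const (2 : ℝ)))
  -- Step 5: the second Hölder factor
  have hpt : ∀ᵐ z ∂L, ψ ((Φ N).flow r z) * R z ^ (2 : ℝ) ≤
      ψ ((Φ N).flow r z) * (cN * Q ((Φ N).flow r z)) := by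
    filter_upwards [(Φ N).ae_mem_good] with z hz
    refine mul_le_mul_right ?_ _
    simp only [hR, hQ, hcN]
    rw [(Φ N).configEnergy_flow hz r,
      ENNReal.ofReal_rpow_of_nonneg (Real.exp_nonneg _) (by norm_num : (0 : ℝ) ≤ 2),
      ← Real.exp_mul, ← ENNReal.ofReal_mul (Real.exp_nonneg _), ← Real.exp_add]
    refine ENNReal.ofReal_le_ofReal (Real.exp_le_exp.2 ?_)
    have hSz := sum_log_ratio_le (Φ N) hz hC0 hC hr.1
    push_cast at hSz
    have hE0 : 0 ≤ configEnergy z := by unfold configEnergy; positivity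
    have hcr : C * (4 * r ^ 2) ≤ γ :=
      (mul_le_mul_of_nonneg_left (mul_le_mul_of_nonneg_left (pow_le_pow_left₀ hr.1 hr.2 2)
        (by norm_num)) hC0).trans (hN₀ N hN).le
    linarith [mul_le_mul_of_nonneg_right hcr hE0]
  have hK0 : 0 ≤ Real.exp (γ * ‖u₀‖ ^ 2) * (1 - 2 * γ * θ₀) ^ (-(3 : ℝ) / 2) :=
    mul_nonneg (Real.exp_nonneg _) (Real.rpow_nonneg (by linarith) _)
  have hKN : (Real.exp (γ * ‖u₀‖ ^ 2) * (1 - 2 * γ * θ₀) ^ (-(3 : ℝ) / 2)) ^ (N + 1) ≤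
      Real.exp (δ * ((N : ℝ) + 1)) := by
    refine (pow_le_pow_left₀ hK0 hK (N + 1)).trans_eq ?_
    rw [← Real.exp_nat_mul]
    congr 1
    push_cast
    ring
  have hint : ∫⁻ z, R z ^ (2 : ℝ) ∂ν ≤ cN ^ (2 : ℝ) :=
    calc ∫⁻ z, R z ^ (2 : ℝ) ∂ν = ∫⁻ z, ψ ((Φ N).flow r z) * R z ^ (2 : ℝ) ∂L := by
          rw [hν, lintegral_withDensity_eq_lintegral_mul L hψΦm (hRm.pow_const (2 : ℝ))]
          rfl
      _ ≤ ∫⁻ z, ψ ((Φ N).flow r z) * (cN * Q ((Φ N).flow r z)) ∂L := lintegral_mono_ae hpt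
      _ = ∫⁻ w, ψ w * (cN * Q w) ∂L :=
          ((Φ N).measurePreserving r).lintegral_comp (f := fun w => ψ w * (cN * Q w))
            (hψm.mul (hQm.const_mul cN))
      _ = cN * ∫⁻ w, Q w ∂(localGibbsLaw σ a (fun _ => u₀) (fun _ => θ₀) N (Φ N)) := by
          rw [hlaw, lintegral_withDensity_eq_lintegral_mul L hψm hQm]
          simp only [Pi.mul_apply]
          rw [← lintegral_const_mul cN hψQm]
          exact lintegral_congr fun w => by ring
      _ ≤ cN * ENNReal.ofReal
            ((Real.exp (γ * ‖u₀‖ ^ 2) * (1 - 2 * γ * θ₀) ^ (-(3 : ℝ) / 2)) ^ (N + 1)) :=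
          mul_le_mul_right (lintegral_exp_mul_configEnergy_localGibbsLaw_le ha continuous_const
            continuous_const ha0 (fun _ => hθ) hσ2 N (Φ N) (Θ := θ₀) (U := ‖u₀‖) hγ0.le
            (fun _ => le_rfl) (fun _ => le_rfl) hγθ) _
      _ ≤ cN * cN := mul_le_mul_right (ENNReal.ofReal_le_ofReal hKN) _
      _ = cN ^ (2 : ℝ) := by rw [ENNReal.rpow_two, sq]
  have hsecond : (∫⁻ z, R z ^ (2 : ℝ) ∂ν) ^ (1 / (2 : ℝ)) ≤ cN :=
    (ENNReal.rpow_le_rpow hint (by norm_num)).trans_eq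
      (by rw [← ENNReal.rpow_mul, show (2 : ℝ) * (1 / 2) = 1 by norm_num, ENNReal.rpow_one])
  -- Step 3: Hölder (2,2) with respect to `ν` and assembly
  have hH := ENNReal.lintegral_mul_le_Lp_mul_Lq ν Real.HolderConjugate.two_two
    hfm.aemeasurable hRm.aemeasurable
  simp only [Pi.mul_apply] at hH
  rw [hlhs]
  refine hH.trans ?_
  rw [hfirst]
  exact (mul_le_mul_right hsecond _).trans_eq (mul_comm _ _)

end Summit.AtomisticToContinuum.HydrodynamicLimit.Theorems.KineticCurrentsWindowLDUniformSketch

end
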